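import Summits.AtomisticToContinuum.BoseEinsteinCondensation.Theorems.PeriodicIRBound.Negative.TwoModeStates

/-!
# Negative lemmas for crux `PeriodicIRBound` (stmt-AtomisticToContinuum-3972), X: hard cores are in scope

Supports (does not close) stmt-AtomisticToContinuum-3972, route `BECGroundStateSOS`. Landed copy of
§19 of `Cruxes/PeriodicIRBound/Disproof.lean` (cycle 2, gen-2 disprover seat); all `sorry`-free,
axioms `propext`/`Classical.choice`/`Quot.sound`.

* §19 `lintegral_hardCore_eq_top`, `hardCore_in_scope`, `periodicIRBound_iff_split` — the hard
  core is admissible (`isRepulsiveFiniteRange_hardCore`) but `∫ hardCore(|x|)dx = ⊤`, so the crux's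
  potential class strictly contains Fournais's Assumption 1.1 class: `Fournais2020_condensation`,
  Born/`‖v‖₁` bounds and `[[H,a_k],a_k†] = |k|² + ρv̂`-type double-commutator (Wagner, f-sum)
  closures are unavailable for it, occupations are not monotone in `v`, and by `periodicIRBound_iff`
  the crux demands `IRBoundFor hardCore` verbatim; a line whose constants involve `‖v‖₁` proves only
  the integrable half of the split.
-/

noncomputable section

open MeasureTheory Filter
open scoped ENNReal NNReal ComplexConjugate BigOperators
namespace Summit.AtomisticToContinuum.BoseEinsteinCondensation.Theorems.PeriodicIRBound.Negative

open Literature.MathematicalPhysics.QuantumManyBody.BoseGas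
open Summit.AtomisticToContinuum.BoseEinsteinCondensation.Theses.BECGroundStateSOS
open Summit.AtomisticToContinuum.BoseEinsteinCondensation.Theorems.GaussianDominationCan.Negative
  (symState symFun oneBody periodicEnergy_symState nsq nsq_nonneg e0 e0_ne_zero norm_e0
    nsq_e0 one_le_norm_intVec isRepulsiveFiniteRange_zero)
open Summit.AtomisticToContinuum.BoseEinsteinCondensation.Theorems.CorrectorClosure.Negative
  (hardCore isRepulsiveFiniteRange_hardCore periodicEnergy_hardCore_eq_top
    periodicGroundStateEnergy_one_eq_top)

variable {L : ℝ} {m : ℕ} {n : Fin 3 → ℤ} {a b : ℝ}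

/-! ## §19 Hard cores are in scope: the crux's class is larger than Fournais's -/

/-- The hard core is not integrable: `∫_{ℝ³} hardCore(|x|) dx = ⊤`. [folklore] -/
theorem lintegral_hardCore_eq_top : (∫⁻ x : Space, hardCore ‖x‖) = ⊤ := by
  have hball : ∀ x ∈ Metric.closedBall (0 : Space) 1, hardCore ‖x‖ = ⊤ := by
    intro x hx
    rw [mem_closedBall_zero_iff] at hx
    simp [hardCore, hx]
  have hle : ∫⁻ x in Metric.closedBall (0 : Space) 1, hardCore ‖x‖ ≤ ∫⁻ x : Space, hardCore ‖x‖ :=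
    setLIntegral_le_lintegral _ _
  rw [setLIntegral_congr_fun measurableSet_closedBall hball, setLIntegral_const] at hle
  have hvol : volume (Metric.closedBall (0 : Space) 1) ≠ 0 :=
    (Metric.measure_closedBall_pos volume _ one_pos).ne'
  rw [ENNReal.top_mul hvol] at hle
  exact top_le_iff.1 hle

/-- **The crux's potential class strictly contains Fournais's Assumption 1.1 class**: the hard
core is admissible (`isRepulsiveFiniteRange_hardCore`) but NOT integrable, so
`Fournais2020_condensation`, `LSSY2005_upperBound_periodic`-type facts stated under
`(∫⁻ v) ≠ ⊤`/`‖v‖₁ < ∞`, first-order (Born) bounds `ρ v̂(0)`, and double commutators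
`[[H, a_k], a_k†] = |k|² + ρ v̂`-type Wagner/f-sum closures are all UNAVAILABLE for it, while by
`periodicIRBound_iff` the crux demands `IRBoundFor hardCore` verbatim. Occupations are not
monotone in `v`, so the hard-core case is not a formal corollary of the integrable case either
(energies are: `E₀(min(v,M)) ↑ E₀(v)`). Any line whose constants involve `‖v‖₁` proves at most the
integrable half (`periodicIRBound_iff_split`). [folklore] -/
theorem hardCore_in_scope :
    IsRepulsiveFiniteRange hardCore ∧ (∫⁻ x : Space, hardCore ‖x‖) = ⊤ ∧
      (PeriodicIRBound → IRBoundFor hardCore) :=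
  ⟨isRepulsiveFiniteRange_hardCore, lintegral_hardCore_eq_top,
    fun h => (periodicIRBound_iff.1 h) hardCore isRepulsiveFiniteRange_hardCore⟩

/-- The crux splits into an INTEGRABLE half (`∫v < ∞`: Fournais's class plus `a = 0` potentials)
and a NON-INTEGRABLE half (hard cores and non-`L¹` spikes) — both required. [folklore] -/
theorem periodicIRBound_iff_split :
    PeriodicIRBound ↔
      (∀ v, IsRepulsiveFiniteRange v → (∫⁻ x : Space, v ‖x‖) ≠ ⊤ → IRBoundFor v) ∧
      (∀ v, IsRepulsiveFiniteRange v → (∫⁻ x : Space, v ‖x‖) = ⊤ → IRBoundFor v) := by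
  rw [periodicIRBound_iff]
  refine ⟨fun h => ⟨fun v hv _ => h v hv, fun v hv _ => h v hv⟩, fun h v hv => ?_⟩
  by_cases htop : (∫⁻ x : Space, v ‖x‖) = ⊤
  · exact h.2 v hv htop
  · exact h.1 v hv htop

end Summit.AtomisticToContinuum.BoseEinsteinCondensation.Theorems.PeriodicIRBound.Negative

end
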